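import Mathlib
import Summits.Ventures.PercRepro2.CrossAPrimeVMarkedCut
import Summits.Ventures.PercRepro2.CrossAPrimeLeafMark

/-!
# Leaf marks scale the v-marked vdB–Kahn statement: a degree-one `v`, `o` or `b` reduces exactly to
its neighbour (blind cell PercRepro2, p5 g40; S4 §2.4 (s) addendum 57)

For the candidate `VMarkedVdBK p ends a₁ v o b` (CrossAPrimeVMarkedVdBK.lean):

* if `v` has exactly one edge `f = {v, w}` (`v ∉ {a₁, o, b, w}`), every `v`-mass is `p f` times the
  `w`-mass (`prob_leaf_bH`: `v ∈ A ⟺ f open ∧ w ∈ A`, the flip of `f` at the isolated `v` being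
  invisible to the avoidances), so SLACK(v) = p f · SLACK(w) (`vMarked_slack_leaf_v`) and
  `VMarkedVdBK` at `w` gives it at `v` (`vMarkedVdBK_of_leaf_v`);
* the degenerate instance `v = b` (`vMarkedVdBK_of_v_eq_b`, the mirror of `v = o`);
* if `o` has exactly one edge `g = {o, u}` (`o ∉ {a₁, v, b, u}`), the `o`-cells are the affine
  combinations `P(E, o ∉ A) = P(E, u ∉ A) + (1 − p g)·P(E, u ∈ A)`, `P(E, o ∈ A) = p g·P(E, u ∈ A)`,
  and the `(1 − p g)`-terms cancel identically: SLACK(o) = p g · SLACK(u) (`vMarked_slack_leaf_o`,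
  `vMarkedVdBK_of_leaf_o`); the mark `b` by the symmetry `vMarkedVdBK_comm` (`vMarkedVdBK_of_leaf_b`).

So the open content of (★₂′) lives on graphs whose marks have degree ≥ 2 — the same reduction
pattern as the cell's `crossA'so_leaf_mark` for the crux.  Tools: `CrossAPrimeLeafMark.prob_leaf_bH`,
`CrossAPrimeIsolatedFlip.conn_update_true_iff_of_isolated`.  Own work; standard axioms.
-/

namespace Summit.Ventures.PercRepro2

open CrossAPrimeVMarked CrossAPrimeVMarkedCut CrossAPrimeLeafMark CrossAPrimeIsolatedFlip

namespace CrossAPrimeVMarkedLeaf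

variable {V : Type*} {E : Type*} [Fintype E] [DecidableEq E] [Fintype V] [DecidableEq V]
  {R : Type*} [Field R] [LinearOrder R] [IsStrictOrderedRing R]
variable {ends : E → Sym2 V}

omit [Fintype V] [LinearOrder R] [IsStrictOrderedRing R] in
/-- The slack of `VMarkedVdBK` as a number. -/
noncomputable def vSlack (p : E → R) (ends : E → Sym2 V) (a₁ v o b : V) : R :=
  prob p (connEvent ends a₁ v) * prob p (avoidAll ends a₁ {o, b}) +
      prob p (avoidAll ends a₁ {o, b} ∩ connEvent ends a₁ v) -
    (prob p (avoidAll ends a₁ {o}) * prob p (avoidAll ends a₁ {b} ∩ connEvent ends a₁ v) +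
      prob p (avoidAll ends a₁ {b}) * prob p (avoidAll ends a₁ {o} ∩ connEvent ends a₁ v))

omit [Fintype V] in
/-- `VMarkedVdBK` is `0 ≤ vSlack`. -/
lemma vMarkedVdBK_iff_vSlack (p : E → R) (ends : E → Sym2 V) (a₁ v o b : V) :
    VMarkedVdBK p ends a₁ v o b ↔ 0 ≤ vSlack p ends a₁ v o b := by
  unfold VMarkedVdBK vSlack
  constructor <;> intro h <;> linarith

section LeafV

omit [Fintype V] [LinearOrder R] [IsStrictOrderedRing R] in
/-- **A leaf `v` scales**: with `f = {v, w}` the only edge at `v` and `v ∉ {a₁, o, b, w}`,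
`vSlack(v) = p f · vSlack(w)`. -/
theorem vMarked_slack_leaf_v (p : E → R) {f : E} {a₁ v o b w : V} (hf : ends f = s(v, w))
    (hv : ∀ e, v ∈ ends e → e = f) (hva₁ : a₁ ≠ v) (hvo : o ≠ v) (hvb : b ≠ v) (hvw : w ≠ v) :
    vSlack p ends a₁ v o b = p f * vSlack p ends a₁ w o b := by
  have hf' : ends f = s(w, v) := by rw [hf, Sym2.eq_swap]
  -- the flips at the isolated `v` are invisible to the avoidances and to `a₁ ↔ w`
  have flip : ∀ ω : Config E, (∀ e, v ∈ ends e → ω e = false) →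
      ((Function.update ω f true ∈ avoidAll ends a₁ {o} ↔ ω ∈ avoidAll ends a₁ {o}) ∧
        (Function.update ω f true ∈ avoidAll ends a₁ {b} ↔ ω ∈ avoidAll ends a₁ {b}) ∧
        (Function.update ω f true ∈ connEvent ends a₁ w ↔ ω ∈ connEvent ends a₁ w)) := by
    intro ω hiso
    refine ⟨?_, ?_, ?_⟩
    · simp only [avoidAll, Set.mem_setOf_eq, Finset.mem_singleton, forall_eq]
      rw [conn_update_true_iff_of_isolated hf' hiso hva₁ hvo]
    · simp only [avoidAll, Set.mem_setOf_eq, Finset.mem_singleton, forall_eq]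
      rw [conn_update_true_iff_of_isolated hf' hiso hva₁ hvb]
    · exact conn_update_true_iff_of_isolated hf' hiso hva₁ hvw
  have hL : prob p (connEvent ends a₁ v) = p f * prob p (connEvent ends a₁ w) := by
    have := prob_leaf_bH (ends := ends) p hf hv hva₁ Set.univ (fun ω hiso => by
      simp only [Set.mem_inter_iff, Set.mem_univ, true_and, (flip ω hiso).2.2])
    simpa only [Set.univ_inter] using this
  have hbL : prob p (avoidAll ends a₁ {b} ∩ connEvent ends a₁ v) =
      p f * prob p (avoidAll ends a₁ {b} ∩ connEvent ends a₁ w) :=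
    prob_leaf_bH (ends := ends) p hf hv hva₁ _ (fun ω hiso => by
      simp only [Set.mem_inter_iff, (flip ω hiso).2.1, (flip ω hiso).2.2])
  have hoL : prob p (avoidAll ends a₁ {o} ∩ connEvent ends a₁ v) =
      p f * prob p (avoidAll ends a₁ {o} ∩ connEvent ends a₁ w) :=
    prob_leaf_bH (ends := ends) p hf hv hva₁ _ (fun ω hiso => by
      simp only [Set.mem_inter_iff, (flip ω hiso).1, (flip ω hiso).2.2])
  have hobL : prob p (avoidAll ends a₁ {o, b} ∩ connEvent ends a₁ v) =
      p f * prob p (avoidAll ends a₁ {o, b} ∩ connEvent ends a₁ w) := by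
    rw [avoidAll_pair]
    exact prob_leaf_bH (ends := ends) p hf hv hva₁ _ (fun ω hiso => by
      simp only [Set.mem_inter_iff, (flip ω hiso).1, (flip ω hiso).2.1, (flip ω hiso).2.2])
  unfold vSlack
  rw [hL, hbL, hoL, hobL]
  ring

omit [Fintype V] in
/-- `VMarkedVdBK` at the neighbour `w` of a leaf `v` gives it at `v`. -/
theorem vMarkedVdBK_of_leaf_v {p : E → R} (hp : IsProbVec p) {f : E} {a₁ v o b w : V}
    (hf : ends f = s(v, w)) (hv : ∀ e, v ∈ ends e → e = f) (hva₁ : a₁ ≠ v) (hvo : o ≠ v)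
    (hvb : b ≠ v) (hvw : w ≠ v) (h : VMarkedVdBK p ends a₁ w o b) :
    VMarkedVdBK p ends a₁ v o b := by
  rw [vMarkedVdBK_iff_vSlack] at h ⊢
  rw [vMarked_slack_leaf_v p hf hv hva₁ hvo hvb hvw]
  exact mul_nonneg (hp.nonneg f) h

end LeafV

section LeafO

omit [Fintype V] [LinearOrder R] [IsStrictOrderedRing R] in
/-- **A leaf mark `o` scales**: with `g = {o, u}` the only edge at `o` and `o ∉ {a₁, v, b, u}`,
`vSlack(o) = p g · vSlack(u)`. -/
theorem vMarked_slack_leaf_o (p : E → R) {g : E} {a₁ v o b u : V} (hg : ends g = s(o, u))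
    (ho : ∀ e, o ∈ ends e → e = g) (hoa₁ : a₁ ≠ o) (hov : v ≠ o) (hob : b ≠ o) (hou : u ≠ o) :
    vSlack p ends a₁ v o b = p g * vSlack p ends a₁ v u b := by
  have hg' : ends g = s(u, o) := by rw [hg, Sym2.eq_swap]
  have flip : ∀ ω : Config E, (∀ e, o ∈ ends e → ω e = false) →
      ((Function.update ω g true ∈ avoidAll ends a₁ {b} ↔ ω ∈ avoidAll ends a₁ {b}) ∧
        (Function.update ω g true ∈ connEvent ends a₁ v ↔ ω ∈ connEvent ends a₁ v) ∧
        (Function.update ω g true ∈ connEvent ends a₁ u ↔ ω ∈ connEvent ends a₁ u)) := by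
    intro ω hiso
    refine ⟨?_, ?_, ?_⟩
    · simp only [avoidAll, Set.mem_setOf_eq, Finset.mem_singleton, forall_eq]
      rw [conn_update_true_iff_of_isolated hg' hiso hoa₁ hob]
    · exact conn_update_true_iff_of_isolated hg' hiso hoa₁ hov
    · exact conn_update_true_iff_of_isolated hg' hiso hoa₁ hou
  -- the four `o ∈ A` masses scale
  have hO : prob p (connEvent ends a₁ o) = p g * prob p (connEvent ends a₁ u) := by
    have := prob_leaf_bH (ends := ends) p hg ho hoa₁ Set.univ (fun ω hiso => by
      simp only [Set.mem_inter_iff, Set.mem_univ, true_and, (flip ω hiso).2.2])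
    simpa only [Set.univ_inter] using this
  have hOL : prob p (connEvent ends a₁ v ∩ connEvent ends a₁ o) =
      p g * prob p (connEvent ends a₁ v ∩ connEvent ends a₁ u) :=
    prob_leaf_bH (ends := ends) p hg ho hoa₁ _ (fun ω hiso => by
      simp only [Set.mem_inter_iff, (flip ω hiso).2.1, (flip ω hiso).2.2])
  have hbO : prob p (avoidAll ends a₁ {b} ∩ connEvent ends a₁ o) =
      p g * prob p (avoidAll ends a₁ {b} ∩ connEvent ends a₁ u) :=
    prob_leaf_bH (ends := ends) p hg ho hoa₁ _ (fun ω hiso => by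
      simp only [Set.mem_inter_iff, (flip ω hiso).1, (flip ω hiso).2.2])
  have hbOL : prob p (avoidAll ends a₁ {b} ∩ connEvent ends a₁ v ∩ connEvent ends a₁ o) =
      p g * prob p (avoidAll ends a₁ {b} ∩ connEvent ends a₁ v ∩ connEvent ends a₁ u) :=
    prob_leaf_bH (ends := ends) p hg ho hoa₁ _ (fun ω hiso => by
      simp only [Set.mem_inter_iff, (flip ω hiso).1, (flip ω hiso).2.1, (flip ω hiso).2.2])
  -- the `o ∉ A` masses as complements
  have k1 : prob p (connEvent ends a₁ v ∩ (connEvent ends a₁ o)ᶜ) =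
      prob p (connEvent ends a₁ v) - p g * prob p (connEvent ends a₁ v ∩ connEvent ends a₁ u) := by
    have := prob_inter_add_prob_inter_compl p (connEvent ends a₁ v) (connEvent ends a₁ o)
    rw [hOL] at this; linear_combination this
  have k1' : prob p (connEvent ends a₁ v ∩ (connEvent ends a₁ u)ᶜ) =
      prob p (connEvent ends a₁ v) - prob p (connEvent ends a₁ v ∩ connEvent ends a₁ u) := by
    have := prob_inter_add_prob_inter_compl p (connEvent ends a₁ v) (connEvent ends a₁ u); linear_combination this
  have k2 : prob p (avoidAll ends a₁ {b} ∩ (connEvent ends a₁ o)ᶜ) =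
      prob p (avoidAll ends a₁ {b}) - p g * prob p (avoidAll ends a₁ {b} ∩ connEvent ends a₁ u) := by
    have := prob_inter_add_prob_inter_compl p (avoidAll ends a₁ {b}) (connEvent ends a₁ o)
    rw [hbO] at this; linear_combination this
  have k2' : prob p (avoidAll ends a₁ {b} ∩ (connEvent ends a₁ u)ᶜ) =
      prob p (avoidAll ends a₁ {b}) - prob p (avoidAll ends a₁ {b} ∩ connEvent ends a₁ u) := by
    have := prob_inter_add_prob_inter_compl p (avoidAll ends a₁ {b}) (connEvent ends a₁ u); linear_combination this
  have k3 : prob p (avoidAll ends a₁ {b} ∩ connEvent ends a₁ v ∩ (connEvent ends a₁ o)ᶜ) =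
      prob p (avoidAll ends a₁ {b} ∩ connEvent ends a₁ v) -
        p g * prob p (avoidAll ends a₁ {b} ∩ connEvent ends a₁ v ∩ connEvent ends a₁ u) := by
    have := prob_inter_add_prob_inter_compl p (avoidAll ends a₁ {b} ∩ connEvent ends a₁ v)
      (connEvent ends a₁ o)
    rw [hbOL] at this; linear_combination this
  have k3' : prob p (avoidAll ends a₁ {b} ∩ connEvent ends a₁ v ∩ (connEvent ends a₁ u)ᶜ) =
      prob p (avoidAll ends a₁ {b} ∩ connEvent ends a₁ v) -
        prob p (avoidAll ends a₁ {b} ∩ connEvent ends a₁ v ∩ connEvent ends a₁ u) := by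
    have := prob_inter_add_prob_inter_compl p (avoidAll ends a₁ {b} ∩ connEvent ends a₁ v)
      (connEvent ends a₁ u); linear_combination this
  -- rewrite the statement's events in terms of `connEvent a₁ o`ᶜ etc.
  have eo : avoidAll ends a₁ {o} = (connEvent ends a₁ o)ᶜ := avoidAll_singleton ends a₁ o
  have eu : avoidAll ends a₁ {u} = (connEvent ends a₁ u)ᶜ := avoidAll_singleton ends a₁ u
  have i1 : avoidAll ends a₁ {o} ∩ connEvent ends a₁ v =
      connEvent ends a₁ v ∩ (connEvent ends a₁ o)ᶜ := by rw [eo, Set.inter_comm]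
  have i1' : avoidAll ends a₁ {u} ∩ connEvent ends a₁ v =
      connEvent ends a₁ v ∩ (connEvent ends a₁ u)ᶜ := by rw [eu, Set.inter_comm]
  have i2 : avoidAll ends a₁ {o, b} = avoidAll ends a₁ {b} ∩ (connEvent ends a₁ o)ᶜ := by
    rw [avoidAll_pair, eo, Set.inter_comm]
  have i2' : avoidAll ends a₁ {u, b} = avoidAll ends a₁ {b} ∩ (connEvent ends a₁ u)ᶜ := by
    rw [avoidAll_pair, eu, Set.inter_comm]
  have i3 : avoidAll ends a₁ {o, b} ∩ connEvent ends a₁ v =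
      avoidAll ends a₁ {b} ∩ connEvent ends a₁ v ∩ (connEvent ends a₁ o)ᶜ := by
    rw [i2]; ext ω; simp only [Set.mem_inter_iff]; tauto
  have i3' : avoidAll ends a₁ {u, b} ∩ connEvent ends a₁ v =
      avoidAll ends a₁ {b} ∩ connEvent ends a₁ v ∩ (connEvent ends a₁ u)ᶜ := by
    rw [i2']; ext ω; simp only [Set.mem_inter_iff]; tauto
  unfold vSlack
  rw [i3, i3', i1, i1', i2, i2', eo, eu, prob_compl, prob_compl, hO, k1, k1', k2, k2', k3, k3']
  ring

omit [Fintype V] in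
/-- `VMarkedVdBK` at the neighbour `u` of a leaf mark `o` gives it at `o`. -/
theorem vMarkedVdBK_of_leaf_o {p : E → R} (hp : IsProbVec p) {g : E} {a₁ v o b u : V}
    (hg : ends g = s(o, u)) (ho : ∀ e, o ∈ ends e → e = g) (hoa₁ : a₁ ≠ o) (hov : v ≠ o)
    (hob : b ≠ o) (hou : u ≠ o) (h : VMarkedVdBK p ends a₁ v u b) :
    VMarkedVdBK p ends a₁ v o b := by
  rw [vMarkedVdBK_iff_vSlack] at h ⊢
  rw [vMarked_slack_leaf_o p hg ho hoa₁ hov hob hou]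
  exact mul_nonneg (hp.nonneg g) h

omit [Fintype V] in
/-- `VMarkedVdBK` at the neighbour `u` of a leaf mark `b` gives it at `b` (by the `o ↔ b`
symmetry). -/
theorem vMarkedVdBK_of_leaf_b {p : E → R} (hp : IsProbVec p) {g : E} {a₁ v o b u : V}
    (hg : ends g = s(b, u)) (hb : ∀ e, b ∈ ends e → e = g) (hba₁ : a₁ ≠ b) (hbv : v ≠ b)
    (hbo : o ≠ b) (hbu : u ≠ b) (h : VMarkedVdBK p ends a₁ v o u) :
    VMarkedVdBK p ends a₁ v o b :=
  (vMarkedVdBK_comm p ends a₁ v o b).2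
    (vMarkedVdBK_of_leaf_o hp hg hb hba₁ hbv hbo hbu ((vMarkedVdBK_comm p ends a₁ v o u).1 h))

end LeafO

section Degenerate

/-- The degenerate instance `v = b` (the mirror of `v = o`): `VMarkedVdBK` holds. -/
theorem vMarkedVdBK_of_v_eq_b {p : E → R} (hp : IsProbVec p) (ends : E → Sym2 V) (a₁ o b : V)
    (hob : o ≠ b) : VMarkedVdBK p ends a₁ b o b :=
  (vMarkedVdBK_comm p ends a₁ b o b).2 (vMarkedVdBK_of_v_eq_o hp ends a₁ b o hob.symm)

end Degenerate

end CrossAPrimeVMarkedLeaf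

end Summit.Ventures.PercRepro2
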